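import Summits.AtomisticToContinuum.Crystallization.Theorems.ThreeConeCertificateSlackRigidityQuasiRegularisation
import Summits.AtomisticToContinuum.Crystallization.Theorems.ThreeConeCertificateSlackRigidityBSLimitSupported
import Summits.AtomisticToContinuum.Crystallization.Theorems.ThreeConeCertificateSlackRigidityLocalLimitGSC
import Summits.AtomisticToContinuum.Crystallization.Theorems.ThreeConeCertificateSlackRigidityPalmReduction
import Summits.AtomisticToContinuum.Crystallization.Theorems.ThreeConeCertificateSlackRigidityUniqFinal
import Literature.Probability.Process.LocalRubberHardCore
import Literature.MathematicalPhysics.StatisticalMechanics.RootEnergy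
import Literature.MathematicalPhysics.StatisticalMechanics.HardCoreGSC
import Literature.MathematicalPhysics.StatisticalMechanics.LennardJonesThermodynamicLimitProofs
import HarnessLib

/-!
# Line `ekeland-surgery-parity` (crux `SlackRigidity`, stmt-AtomisticToContinuum-11960): the crux from rigidity of minimising GSC-supported point-stationary hard-core laws

The GSC refinement of the line (lead c6, cycle 2).  `slackRigidity_of_rootLawRigidity`: the crux
`SlackRigidity` follows from `RootLawRigidity` — the planner's load-bearing statement
`RootLawRigidityLe` = the planner's stub 5 `RootLawRigidity` with `∫ rootEnergy ≤ e` in place of `= e` (the two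
are equivalent by the landed item 9229 `UnimodularEnergyLowerBound`, whose module cannot be imported next to the
GSC files — `MuGSC` and `MuGroundStateConfiguration` both declare `UniformlyDiscrete`): there is ONE periodic template `P₀`
such that every probability law on rooted configurations of `ℝ³` that is a.s. rooted `δ`-hard-core,
point-stationary, a.s. carried by hard-core ground-state configurations (`IsHardCoreGSC`) and has mean
root energy at most the thermodynamic limit `e = lim E(N)/N`, has for every `R, ε > 0` almost surely
an `(R, ε)`-good root.  This residual is UNFILED and WEAKER than item 9224 `PalmRigidity` both in
input (GSC support is available; `∫ rootEnergy ≤ e = ⨅_Q e(Q)`, hence `= e` by item 9229) and in output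
(matching to one template only).

Composition (all inputs landed): Hamming–Ekeland regularisation of the near-minimisers into
`1/3`-separated `λ_N → 0` quasi-ground-states with bad counts under control
(`EkelandQuasiRegularisation.quasiRegularisation`, p123819) → a bad subsequence → Benjamini–Schramm
limit WITH SUPPORT (`EkelandBSLimitSupported.stub_hardCoreBSLimit`) → the limit law is a.s. carried by
hard-core GSCs (`EkelandLocalLimitGSC.stub_localLimitGSC`: local limits of quasi-ground-states are
GSCs) and is minimising (`∫ rootEnergy ≤ e` by `BlancLewin2015_8_holds` + excess `o(N)`) → the
hypothesis gives a.s. good roots → density transfer back to the finite configurations contradicts a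
positive bad fraction.  The proof text is the planner's composition of the original skeleton of the
line (`badFractionVanishes_of_hyps`) with the unimodular energy bound step removed.  Finally
`rootLawRigidity_of_palmRigidity : PalmRigidity → RootLawRigidity` (drop the GSC hypothesis; `e = ⨅_Q e(Q)`
by the landed `crysEnergyLimit`; uniqueness of the optimum up to congruence) certifies that the new
residual is WEAKER than item 9224, and `slackRigidity_of_palmRigidity_viaGSC` re-derives the landed
closure through it.  All `[folklore]`.
-/

noncomputable section

open scoped BigOperators Topology
open MeasureTheory Filter Set
open Literature.MathematicalPhysics.StatisticalMechanics
open Literature.Probability.Process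
open Summit.AtomisticToContinuum.Crystallization.Theses.ThreeConeCertificate (SlackRigidity)
open Summit.AtomisticToContinuum.Crystallization.Theses.PalmUnimodularRigidity (PalmRigidity)
open Summit.AtomisticToContinuum.Crystallization.Theorems.SlackRigidityNegative
open Summit.AtomisticToContinuum.Crystallization.Theorems.ChargedEnergyGapNegative
  (crysEnergyLimit bddBelow_energyPerParticle_lennardJones)

namespace Summit.AtomisticToContinuum.Crystallization.Theorems.EkelandRootLawReduction

/-! ### Vocabulary helpers (from the planner's skeleton of the line) -/

/-- The crux's matching predicate `Good P R ε x i` (landed negative module, verbatim the predicate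
negated inside `SlackRigidity`) is local `(R, ε)`-matching of the configuration recentred at `x i`
with a rotated template. [folklore] -/
theorem good_iff {P : PeriodicConfiguration 3} {R ε : ℝ} {N : ℕ} {x : Fin N → E3} {i : Fin N} :
    Good P R ε x i ↔
      ∃ A : E3 →ₗᵢ[ℝ] E3, LocallyMatches R ε (Set.range fun j => x j - x i) (A '' P.points) := by
  unfold Good
  refine exists_congr fun A => ?_
  have h := locallyMatches_range_sub_pattern_iff (R := R) (ε := ε) x i A P.points 0
  simp only [sub_zero, dist_zero_right] at h
  exact h.symm

/-- `Good` is monotone in the tolerance. [folklore] -/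
theorem Good.mono_right {P : PeriodicConfiguration 3} {R ε ε' : ℝ} {N : ℕ} {x : Fin N → E3}
    {i : Fin N} (h : Good P R ε x i) (hε : ε ≤ ε') : Good P R ε' x i := by
  rw [good_iff] at h ⊢
  obtain ⟨A, hA⟩ := h
  exact ⟨A, hA.mono le_rfl hε⟩

/-- Subtype counting on `Fin N`: monotone under implication. [folklore] -/
theorem natCard_subtype_le {N : ℕ} {p q : Fin N → Prop} (h : ∀ i, p i → q i) :
    Nat.card {i // p i} ≤ Nat.card {i // q i} := by
  classical
  rw [Nat.card_eq_fintype_card, Nat.card_eq_fintype_card]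
  exact Fintype.card_subtype_mono p q h

/-- Subtype counting on `Fin N`: a predicate and its negation exhaust `Fin N`. [folklore] -/
theorem natCard_subtype_add_compl {N : ℕ} (p : Fin N → Prop) :
    Nat.card {i // p i} + Nat.card {i // ¬ p i} = N := by
  classical
  rw [Nat.card_eq_fintype_card, Nat.card_eq_fintype_card, Fintype.card_subtype_compl,
    Fintype.card_fin]
  have : Fintype.card {i // p i} ≤ N := by
    simpa using Fintype.card_subtype_le p
  omega

/-- Bad counts are antitone in the tolerance. [folklore] -/
theorem badCount_anti {P : PeriodicConfiguration 3} {R ε ε' : ℝ} {N : ℕ} (x : Fin N → E3)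
    (hε : ε ≤ ε') : badCount P R ε' x ≤ badCount P R ε x :=
  natCard_subtype_le fun i (hb : ¬ Good P R ε' x i) (hg : Good P R ε x i) =>
    hb (Good.mono_right hg hε)

/-! ### The composition -/

/-- **Core of the composition** (tolerance `ε ≤ 1`): along an injective `o(N)`-excess sequence the
`(R, ε)`-bad fraction w.r.t. `P₀` tends to `0`, given the LANDED regularisation
(`EkelandQuasiRegularisation.quasiRegularisation`), the Benjamini–Schramm limit with support
(`stub_hardCoreBSLimit`), GSC of local limits (`stub_localLimitGSC`) and the rigidity of minimising
GSC-supported point-stationary hard-core laws for `P₀` (hypothesis `hRig` = the planner's `RootLawRigidity`, stub 5 of the original skeleton, with `≤ e`). [folklore] -/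
theorem badFractionVanishes_of_rootLawRigidity {P₀ : PeriodicConfiguration 3}
    (hRig : ∀ e : ℝ,
      Tendsto (fun N : ℕ => groundStateEnergy lennardJones 3 N / (N : ℝ)) atTop (𝓝 e) →
      ∀ δ : ℝ, 0 < δ → ∀ P : Measure (Measure E3), IsProbabilityMeasure P →
        (∀ᵐ μ ∂P, IsRootedHardCore δ μ) → IsPointStationaryLaw P →
        (∀ᵐ μ ∂P, IsHardCoreGSC lennardJones (atoms μ)) →
        (∫ μ, rootEnergy lennardJones μ ∂P) ≤ e →
        ∀ R ε : ℝ, 0 < R → 0 < ε →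
          ∀ᵐ μ ∂P, ∃ A : E3 →ₗᵢ[ℝ] E3, LocallyMatches R ε (atoms μ) (A '' P₀.points))
    {R ε : ℝ} (hR : 0 < R) (hε : 0 < ε) (hε1 : ε ≤ 1)
    {x : (N : ℕ) → (Fin N → E3)} (hx : ∀ N, Function.Injective (x N)) (hex : ExcessVanishes x) :
    BadFractionVanishes P₀ R ε x := by
  -- the thermodynamic limit `e = lim E(N)/N` (Blanc–Lewin (8), proved in tree)
  obtain ⟨e, -, he, -⟩ := BlancLewin2015_8_holds 3 (by norm_num) (by norm_num)
  unfold BadFractionVanishes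
  unfold ExcessVanishes at hex
  by_contra hnot
  -- Step 1: Hamming–Ekeland regularisation
  obtain ⟨x', lam, err, -, hlam, hQ, hsep, hE, herr, hbad⟩ :=
    EkelandQuasiRegularisation.quasiRegularisation P₀ R ε hR hε x hx hex
  have hnot' : ¬ Tendsto (fun N : ℕ => (badCount P₀ R ε (x' N) : ℝ) / N) atTop (𝓝 0) := by
    intro h'
    apply hnot
    have hup : Tendsto (fun N : ℕ => (badCount P₀ R ε (x' N) : ℝ) / N + err N / N) atTop (𝓝 0) := by
      simpa using h'.add herr
    refine tendsto_of_tendsto_of_tendsto_of_le_of_le tendsto_const_nhds hup (fun N => ?_)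
      (fun N => ?_)
    · positivity
    · show (badCount P₀ R ε (x N) : ℝ) / N ≤ (badCount P₀ R ε (x' N) : ℝ) / N + err N / N
      rw [← add_div]
      exact div_le_div_of_nonneg_right (hbad N) (Nat.cast_nonneg N)
  obtain ⟨θ, hθ, hfreq⟩ :=
    CLayerWitnessRooting.exists_frequently_le_of_not_tendsto (fun N => by positivity) hnot'
  -- Step 2: a subsequence `ψ` of particle numbers `≥ 1` with bad fraction `≥ θ`
  obtain ⟨ψ, hψ, hψP⟩ := extraction_of_frequently_atTop (hfreq.and_eventually (eventually_ge_atTop 1))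
  have hM1 : ∀ k, 1 ≤ ψ k := fun k => (hψP k).2
  -- Step 3: Benjamini–Schramm limit of the rooted regularised configurations
  obtain ⟨φ, hφ, P, hP, hcore, hstat, hsupp, hEn, htr⟩ :=
    EkelandBSLimitSupported.stub_hardCoreBSLimit (1 / 3) (by norm_num) ψ (fun k => x' (ψ k)) hM1
      (fun k i j hij => hsep (ψ k) i j hij)
  haveI := hP
  -- Step 4: the limit law is carried by hard-core GSCs (local limits of quasi-ground-states)
  have hgsc : ∀ᵐ μ ∂P, IsHardCoreGSC lennardJones (atoms μ) := by
    filter_upwards [hsupp] with μ hμ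
    obtain ⟨ψ', hψ', i, hlim⟩ := hμ
    refine EkelandLocalLimitGSC.stub_localLimitGSC (1 / 3) (by norm_num) (fun k => ψ (φ (ψ' k))) (fun k => x' (ψ (φ (ψ' k))))
      (fun k => x' (ψ (φ (ψ' k))) (i k)) (fun k => lam (ψ (φ (ψ' k)))) (fun k => hQ _) ?_
      (fun k a b hab => hsep _ a b hab) (atoms μ) hlim
    exact hlam.comp ((hψ.comp (hφ.comp hψ')).tendsto_atTop)
  -- Step 5: the limit law is minimising, `E_P[h] ≤ e`
  have hEx : Tendsto (fun j : ℕ => interactionEnergy lennardJones (x (ψ (φ j))) / (ψ (φ j) : ℝ))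
      atTop (𝓝 e) := by
    have hsub : Tendsto (fun j => ψ (φ j)) atTop atTop := (hψ.comp hφ).tendsto_atTop
    have h1 : Tendsto (fun j : ℕ => groundStateEnergy lennardJones 3 (ψ (φ j)) / (ψ (φ j) : ℝ))
        atTop (𝓝 e) := he.comp hsub
    have h2 : Tendsto (fun j : ℕ => (interactionEnergy lennardJones (x (ψ (φ j))) -
        groundStateEnergy lennardJones 3 (ψ (φ j))) / (ψ (φ j) : ℝ)) atTop (𝓝 0) := hex.comp hsub
    have h3 := h1.add h2
    rw [add_zero] at h3
    refine h3.congr fun j => ?_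
    have hne : (ψ (φ j) : ℝ) ≠ 0 := by
      have : 1 ≤ ψ (φ j) := hM1 _
      exact_mod_cast Nat.one_le_iff_ne_zero.1 this
    field_simp
    ring
  have hElim : (∫ μ, rootEnergy lennardJones μ ∂P) ≤ e :=
    le_of_tendsto_of_tendsto' hEn hEx fun j =>
      div_le_div_of_nonneg_right (hE _) (Nat.cast_nonneg _)
  -- Step 6: rigidity of the limit law — almost surely the root is `(R + 1, ε/2)`-good
  have hgood : ∀ᵐ μ ∂P, ∃ A : E3 →ₗᵢ[ℝ] E3,
      LocallyMatches (R + 1) (ε / 2) (atoms μ) (A '' P₀.points) :=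
    hRig e he (1 / 3) (by norm_num) P hP hcore hstat hgsc hElim (R + 1) (ε / 2) (by linarith)
      (by linarith)
  -- Step 7: density transfer back to the finite configurations
  set T : Set (Measure E3) :=
    {ν | ∃ A : E3 →ₗᵢ[ℝ] E3, LocallyMatches (R + 1) (ε / 2) (atoms ν) (A '' P₀.points)} with hT
  have hTc : P Tᶜ = 0 := by
    have := ae_iff.1 hgood
    rwa [hT, Set.compl_setOf]
  have hPT : P T = 1 := by
    refine le_antisymm prob_le_one ?_
    calc (1 : ENNReal) = P Set.univ := measure_univ.symm
      _ = P (T ∪ Tᶜ) := by rw [Set.union_compl_self]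
      _ ≤ P T + P Tᶜ := measure_union_le T Tᶜ
      _ = P T := by rw [hTc, add_zero]
  have hρ : 1 - θ / 2 < (P T).toReal := by
    rw [hPT, ENNReal.toReal_one]
    linarith
  obtain ⟨j, hj⟩ := (htr T (R + 1) (ε / 2) (by linarith) (1 - θ / 2) hρ).exists
  -- matched particles are `(R, ε)`-good: margin `ε/2 + ε/2 = ε`, radius `R + 1 → R`
  have hsubset : ∀ i : Fin (ψ (φ j)),
      (∃ ν ∈ T, LocallyMatches (R + 1) (ε / 2)
        (Set.range fun k : Fin (ψ (φ j)) => x' (ψ (φ j)) k - x' (ψ (φ j)) i) (atoms ν)) →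
      Good P₀ R ε (x' (ψ (φ j))) i := by
    rintro i ⟨ν, ⟨A, hA⟩, hm⟩
    rw [good_iff]
    refine ⟨A, ?_⟩
    have h := hm.trans hA (by linarith) (by linarith) (show R + ε / 2 ≤ R + 1 by linarith)
      (show R + ε / 2 ≤ R + 1 by linarith)
    rwa [add_halves] at h
  have hcount : (Nat.card {i : Fin (ψ (φ j)) // ∃ ν ∈ T, LocallyMatches (R + 1) (ε / 2)
      (Set.range fun k : Fin (ψ (φ j)) => x' (ψ (φ j)) k - x' (ψ (φ j)) i) (atoms ν)} : ℝ) ≤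
      Nat.card {i : Fin (ψ (φ j)) // Good P₀ R ε (x' (ψ (φ j))) i} := by
    exact_mod_cast natCard_subtype_le hsubset
  have hsum : (Nat.card {i : Fin (ψ (φ j)) // Good P₀ R ε (x' (ψ (φ j))) i} : ℝ) +
      badCount P₀ R ε (x' (ψ (φ j))) = ψ (φ j) := by
    unfold badCount
    exact_mod_cast natCard_subtype_add_compl (fun i : Fin (ψ (φ j)) => Good P₀ R ε (x' (ψ (φ j))) i)
  have hθj := (hψP (φ j)).1
  have hn : (1 : ℝ) ≤ ψ (φ j) := by exact_mod_cast hM1 (φ j)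
  rw [le_div_iff₀ (by linarith)] at hθj
  nlinarith

/-- Tolerances may be assumed `≤ 1`: goodness is monotone in `ε`. [folklore] -/
theorem rigidFor_of_le_one {P₀ : PeriodicConfiguration 3}
    (hcore : ∀ R ε : ℝ, 0 < R → 0 < ε → ε ≤ 1 → ∀ x : (N : ℕ) → (Fin N → E3),
      (∀ N, Function.Injective (x N)) → ExcessVanishes x → BadFractionVanishes P₀ R ε x) :
    RigidFor P₀ := by
  intro R ε hR hε x hx hex
  have h := hcore R (min ε 1) hR (lt_min hε one_pos) (min_le_right _ _) x hx hex
  unfold BadFractionVanishes at h ⊢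
  refine tendsto_of_tendsto_of_tendsto_of_le_of_le tendsto_const_nhds h (fun N => ?_) (fun N => ?_)
  · positivity
  · exact div_le_div_of_nonneg_right
      (Nat.cast_le.2 (badCount_anti (P := P₀) (R := R) (x N) (min_le_left ε 1)))
      (Nat.cast_nonneg N)

/-- **Composition** (sorry-free given `stub_hardCoreBSLimit`, `stub_localLimitGSC`): rigidity of
minimising GSC-SUPPORTED point-stationary hard-core laws (`RootLawRigidityLe`: the planner's
`RootLawRigidity`, stub 5 of the original skeleton, with `≤ e`; UNFILED, weaker than item 9224 in input — GSC
support available — and in output — matching only) implies the crux. [folklore] -/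
theorem slackRigidity_of_rootLawRigidity :
    (∃ P₀ : PeriodicConfiguration 3, ∀ e : ℝ,
      Tendsto (fun N : ℕ => groundStateEnergy lennardJones 3 N / (N : ℝ)) atTop (𝓝 e) →
      ∀ δ : ℝ, 0 < δ → ∀ P : Measure (Measure E3), IsProbabilityMeasure P →
        (∀ᵐ μ ∂P, IsRootedHardCore δ μ) → IsPointStationaryLaw P →
        (∀ᵐ μ ∂P, IsHardCoreGSC lennardJones (atoms μ)) →
        (∫ μ, rootEnergy lennardJones μ ∂P) ≤ e →
        ∀ R ε : ℝ, 0 < R → 0 < ε →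
          ∀ᵐ μ ∂P, ∃ A : E3 →ₗᵢ[ℝ] E3, LocallyMatches R ε (atoms μ) (A '' P₀.points)) →
    SlackRigidity := by
  intro hRig
  obtain ⟨P₀, hP₀⟩ := hRig
  exact ⟨P₀, rigidFor_of_le_one fun R ε hR hε hε1 x hx hex =>
    badFractionVanishes_of_rootLawRigidity hP₀ hR hε hε1 hx hex⟩

/-! ### The residual is weaker than item 9224 -/

/-- **`PalmRigidity` (item 9224) implies `RootLawRigidityLe`** — the residual of the GSC refinement
is WEAKER than the filed item: drop the GSC hypothesis, identify `e = lim E(N)/N = ⨅_Q e(Q)`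
(landed `crysEnergyLimit`), apply Palm rigidity (a.s. a rotated optimal relaxed hcp through the
root), move to the fixed template `hcp(a₀, h₀)` by the landed uniqueness of the optimum up to
congruence (`stub_hcpOptimalCongruent`), and match the sample with itself. [folklore] -/
theorem rootLawRigidity_of_palmRigidity (hPalm : PalmRigidity) :
    ∃ P₀ : PeriodicConfiguration 3, ∀ e : ℝ,
      Tendsto (fun N : ℕ => groundStateEnergy lennardJones 3 N / (N : ℝ)) atTop (𝓝 e) →
      ∀ δ : ℝ, 0 < δ → ∀ P : Measure (Measure E3), IsProbabilityMeasure P →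
        (∀ᵐ μ ∂P, IsRootedHardCore δ μ) → IsPointStationaryLaw P →
        (∀ᵐ μ ∂P, IsHardCoreGSC lennardJones (atoms μ)) →
        (∫ μ, rootEnergy lennardJones μ ∂P) ≤ e →
        ∀ R ε : ℝ, 0 < R → 0 < ε →
          ∀ᵐ μ ∂P, ∃ A : E3 →ₗᵢ[ℝ] E3, LocallyMatches R ε (atoms μ) (A '' P₀.points) := by
  obtain ⟨a₀, h₀, ha₀, hh₀, h1, h2, h3, h4, hopt⟩ :=
    EkelandSurgeryParityReduction.exists_optimal_of_palmRigidity hPalm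
  refine ⟨hcpPeriodicConfiguration ha₀ hh₀, fun e he δ hδ P hP hcore hstat _ hE R ε _ hε => ?_⟩
  have heq : e = ⨅ Q : PeriodicConfiguration 3, Q.energyPerParticle lennardJones :=
    tendsto_nhds_unique he crysEnergyLimit
  have hE' : (∫ μ, (∫ y, lennardJones ‖y‖ ∂μ) / 2 ∂P) ≤
      ⨅ Q : PeriodicConfiguration 3, Q.energyPerParticle lennardJones := by
    rw [← heq]
    exact hE
  have hae := hPalm δ hδ P hP hcore hstat hE'
  have hmin₀ : ∀ (b k : ℝ) (hb : b ≠ 0) (hk : k ≠ 0), 1 / 2 ≤ b → b ≤ 2 → 1 / 2 ≤ k → k ≤ 2 →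
      (hcpPeriodicConfiguration ha₀ hh₀).energyPerParticle lennardJones ≤
        (hcpPeriodicConfiguration hb hk).energyPerParticle lennardJones := by
    intro b k hb hk _ _ _ _
    rw [hopt]
    exact ciInf_le bddBelow_energyPerParticle_lennardJones _
  filter_upwards [hae] with μ hμ
  obtain ⟨a, h, ha, hh, b1, b2, b3, b4, A, hopt', rfl⟩ := hμ
  have hmin : ∀ (b k : ℝ) (hb : b ≠ 0) (hk : k ≠ 0), 1 / 2 ≤ b → b ≤ 2 → 1 / 2 ≤ k → k ≤ 2 →
      (hcpPeriodicConfiguration ha hh).energyPerParticle lennardJones ≤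
        (hcpPeriodicConfiguration hb hk).energyPerParticle lennardJones := by
    intro b k hb hk _ _ _ _
    rw [hopt']
    exact ciInf_le bddBelow_energyPerParticle_lennardJones _
  obtain ⟨B, hB⟩ := EkelandSurgeryParityUniqFinal.stub_hcpOptimalCongruent a₀ h₀ a h ha₀ hh₀ ha hh
    h1 h2 h3 h4 b1 b2 b3 b4 hmin₀ hmin
  refine ⟨A.toLinearIsometry.comp B, ?_⟩
  rw [atoms_count_restrict, hB, ← Set.image_comp, LinearIsometry.coe_comp,
    LinearIsometryEquiv.coe_toLinearIsometry, hcpPeriodicConfiguration_points]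
  exact locallyMatches_self hε.le _ _


/-- **Consistency: `PalmRigidity ⇒ SlackRigidity` through the GSC route** — a second, independent
kernel-checked proof of the landed closure `EkelandSurgeryParityClosure.slackRigidity_of_palmRigidity`
(p122051), now factoring through the weaker residual `RootLawRigidityLe`. [folklore] -/
theorem slackRigidity_of_palmRigidity_viaGSC (hPalm : PalmRigidity) : SlackRigidity :=
  slackRigidity_of_rootLawRigidity (rootLawRigidity_of_palmRigidity hPalm)

end Summit.AtomisticToContinuum.Crystallization.Theorems.EkelandRootLawReduction

end
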